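import Literature.NumberTheory.Transcendental.KaehlerDDbarLemmaProofs
import Literature.Analysis.Complex.DolbeaultInvariance
import Literature.Algebra.Homology.CechTupleFaces
import HarnessLib

/-!
# The `∂∂̄`-descent on the strata of a normal-crossing configuration

Topic `Literature/Geometry/Kaehler`. The compact-Kähler core of P. Deligne's Cor. 8.2.8 of
*Théorie de Hodge III* (Publ. Math. IHÉS 44 (1974), p. 40) for a simple normal crossing
configuration, by the "direct route" of P. Deligne, Ph. Griffiths, J. Morgan, D. Sullivan, *Real
homotopy theory of Kähler manifolds*, Invent. Math. 29 (1975), §5 (the `∂∂̄`-lemma): the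
obstructions to descending the exactness of a class of pure Hodge type from the components
`D_i` of the configuration to their union are classes on the iterated intersections
`D_{i₀} ∩ ⋯ ∩ D_{i_a}` which are simultaneously `d`-closed and `∂̄`-exact of pure type, hence
`∂∂̄`-exact by the `∂∂̄`-lemma (`Literature.NumberTheory.Transcendental.ddbar_of_dolbeaultBar`).

## Setting: strata systems

The analytic shadow of a finite family of smooth closed subvarieties `(D_i)_{i ∈ ι}` of a smooth
variety whose iterated intersections are smooth (e.g. the components of a simple normal crossing
divisor): an ambient complex manifold `M` (charted on `EM`) and, for every finite set of indices
`I : Finset ι`, a complex manifold `P I` (charted on `EP I`; the analytification of `⋂_{i∈I} D_i`,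
possibly empty or disconnected) with holomorphic maps `emb I : P I → M` and
`res : P J → P I` for `I ⊆ J`, subject to `emb I ∘ res = emb J` and the cocycle condition
(`StrataMaps`). No transversality is recorded: only the smoothness of the strata matters here.

On the strata we have the **strata cochains** `SCochain EP P a b` — families of complex `b`-forms
on the `P (tupleSupport J)` over all ordered tuples `J : Fin (a + 1) → ι` — with the Čech
differential `StrataMaps.delta` (`(δc)_J = Σ_j (-1)^j res^* c_{J ∘ σ_j}`, `σ_j = Fin.succAbove j`,
the SAME convention as the tree's Čech–de Rham `cechδ` of `Geometry/Kaehler/CechDeRham.lean`) and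
the restriction `StrataMaps.sres x` of an ambient form to the column `a = 0`.

## Main result

`StrataMaps.exists_ddbar_descent`: let `x` be a smooth complex form of degree `k + 2` and pure type
`(p + 1, q + 1)` on `M` whose restriction to each `P {i}` is `d`-exact, and assume every stratum is
a compact Hausdorff Kähler manifold. Then there is a strata cochain `η` (all bidegrees, junk `0`
off the antidiagonal `a + b = k + 1`) of smooth forms with
`d η_{(i)} = x|_{P {i}}` and `δ η_a + (-1)^{a+1} d η_{a+1} = 0`, i.e. `(x|_{P i})_i` is a
coboundary in the total complex of the strata double complex. Construction (§3): potentials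
`pot a` with `η_a = ∂̄ pot_a`, `pot 0` from `x| = ∂∂̄ pot₀` (`ddbar_of_exact`) and `pot (a+1)` from
`δ(∂̄ pot_a) = ∂̄ θ`, `θ = δ pot_a`, `d ∂̄θ = 0`, `∂̄θ = ∂∂̄β` (`ddbar_of_dolbeaultBar`); the types
drop from `(p, q)` by `(1, 0)` at each level and the descent stops at level `p`
(`dolbeaultBar_eq_zero_of_isOfType_zero_left`).

Also: `StrataMaps.delta_delta` (`δ ∘ δ = 0`, the tuple combinatorics of
`Literature.Algebra.Homology.CechTuple`), `StrataMaps.delta_sres` (`δ ∘ r = 0`), and the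
commutation of `δ` with `d` and `∂̄`. Everything is proved; no named facts (D-0026). This is brick
[B] of the programme recorded in `Literature/AlgebraicGeometry/HodgeTheory/GysinKernelSplitRationalCore.lean`
(the direct route to Hodge III, Prop. 8.2.7 / Cor. 8.2.8 on the tree's compact Kähler carriers).

## References

* P. Deligne, Ph. Griffiths, J. Morgan, D. Sullivan, *Real homotopy theory of Kähler manifolds*,
  Invent. Math. 29 (1975), §5 (Lemma 5.11 and the `dd^c`-lemma), §6. [DeligneGriffithsMorganSullivan1975]
* P. Deligne, *Théorie de Hodge II*, Publ. Math. IHÉS 40 (1971), 3.2.13 (degeneration of the weight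
  spectral sequence); *Théorie de Hodge III*, Publ. Math. IHÉS 44 (1974), 8.2.7–8.2.8. [DeligneHodgeIII1974]
* R. Bott, L. W. Tu, *Differential Forms in Algebraic Topology* (1982), §8 (8.4) (the Čech
  differential on ordered tuples). [BottTu1982Forms]
* C. Voisin, *Hodge Theory and Complex Algebraic Geometry I* (2002), Prop. 6.17. [VoisinHodgeI2002]
-/

noncomputable section

open scoped Manifold ContDiff Topology
open Set Function Finset Literature.NumberTheory.Transcendental

namespace Literature.Geometry.Kaehler

-- The identification `TangentSpace I x = E` is an abuse of definitional equality (see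
-- `NormedSpace.fromTangentSpace`); as in Mathlib's tangent-bundle files we let `isDefEq` unfold it.
set_option backward.isDefEq.respectTransparency false

/-! ### §1 Tuples, strata systems, strata cochains -/

section Tuples

variable {ι : Type} [DecidableEq ι]

/-- The set of indices occurring in an ordered tuple `J = (i₀, …, i_{n-1})`. [folklore] -/
def tupleSupport {n : ℕ} (J : Fin n → ι) : Finset ι :=
  univ.image J

/-- Every entry of a tuple lies in its support. [folklore] -/
theorem mem_tupleSupport {n : ℕ} (J : Fin n → ι) (x : Fin n) : J x ∈ tupleSupport J :=
  mem_image_of_mem J (mem_univ x)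

/-- The support of a reindexed tuple `J ∘ θ` is contained in the support of `J` (faces of a tuple
have smaller support). [folklore] -/
theorem tupleSupport_comp_subset {m n : ℕ} (J : Fin n → ι) (θ : Fin m → Fin n) :
    tupleSupport (J ∘ θ) ⊆ tupleSupport J := by
  intro i hi
  rw [tupleSupport, Finset.mem_image] at hi ⊢
  obtain ⟨x, -, rfl⟩ := hi
  exact ⟨θ x, Finset.mem_univ _, rfl⟩

end Tuples

section Strata

variable {ι : Type} [DecidableEq ι]
  {EM : Type*} [NormedAddCommGroup EM] [NormedSpace ℂ EM]

/-- **A strata system** over the complex manifold `M`: for every finite set of indices `I` a complex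
manifold `P I` (charted on `EP I`) with a holomorphic map `emb I : P I → M` and holomorphic
restriction maps `res : P J → P I` for `I ⊆ J`, with `emb I ∘ res = emb J`, `res_{I,I} = id` and
`res_{I,J} ∘ res_{J,K} = res_{I,K}`; real smoothness is recorded alongside holomorphy (it follows
from it, but both are consumed). The intended instance is the family of analytifications of the
iterated intersections `⋂_{i∈I} D_i` of smooth closed subvarieties with smooth intersections (a
simple normal crossing configuration), `emb`/`res` the inclusions.
[cite: DeligneHodgeIII1974, 8.2.7–8.2.8] [cite: DeligneGriffithsMorganSullivan1975, §5] -/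
structure StrataMaps (M : Type*) [TopologicalSpace M] [ChartedSpace EM M]
    (EP : Finset ι → Type*) [∀ I, NormedAddCommGroup (EP I)] [∀ I, NormedSpace ℂ (EP I)]
    (P : Finset ι → Type*) [∀ I, TopologicalSpace (P I)] [∀ I, ChartedSpace (EP I) (P I)] where
  /-- The map of the stratum `P I` to the ambient manifold. -/
  emb : ∀ I : Finset ι, P I → M
  /-- The restriction map `P J → P I` for `I ⊆ J` (the bigger the index set, the smaller the stratum). -/
  res : ∀ ⦃I J : Finset ι⦄, I ⊆ J → P J → P I
  /-- Compatibility of the restrictions with the maps to `M`. -/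
  emb_comp_res : ∀ ⦃I J : Finset ι⦄ (h : I ⊆ J), emb I ∘ res h = emb J
  /-- `res_{I,I} = id`. -/
  res_self : ∀ (I : Finset ι) (h : I ⊆ I), res h = id
  /-- The cocycle condition `res_{I,J} ∘ res_{J,K} = res_{I,K}`. -/
  res_comp_res : ∀ ⦃I J K : Finset ι⦄ (hIJ : I ⊆ J) (hJK : J ⊆ K),
    res hIJ ∘ res hJK = res (hIJ.trans hJK)
  /-- `emb I` is holomorphic. -/
  mdifferentiable_emb : ∀ I, MDifferentiable 𝓘(ℂ, EP I) 𝓘(ℂ, EM) (emb I)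
  /-- `emb I` is real `C^∞`. -/
  contMDiff_emb : ∀ I, ContMDiff 𝓘(ℝ, EP I) 𝓘(ℝ, EM) ∞ (emb I)
  /-- `res` is holomorphic. -/
  mdifferentiable_res : ∀ ⦃I J : Finset ι⦄ (h : I ⊆ J), MDifferentiable 𝓘(ℂ, EP J) 𝓘(ℂ, EP I) (res h)
  /-- `res` is real `C^∞`. -/
  contMDiff_res : ∀ ⦃I J : Finset ι⦄ (h : I ⊆ J), ContMDiff 𝓘(ℝ, EP J) 𝓘(ℝ, EP I) ∞ (res h)

variable (EP : Finset ι → Type*) [∀ I, NormedAddCommGroup (EP I)] [∀ I, NormedSpace ℂ (EP I)]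
  (P : Finset ι → Type*) [∀ I, TopologicalSpace (P I)] [∀ I, ChartedSpace (EP I) (P I)] in
/-- **Strata cochains** of bidegree `(a, b)`: complex `b`-forms on the strata `P (tupleSupport J)`
over all ordered `(a+1)`-tuples `J` (the full ordered Čech complex, Bott–Tu (1982), §8, p. 93).
[cite: BottTu1982Forms, §8 (8.1)] -/
abbrev SCochain (a b : ℕ) : Type _ :=
  ∀ J : Fin (a + 1) → ι, MForm 𝓘(ℝ, EP (tupleSupport J)) (P (tupleSupport J)) ℂ b

variable {M : Type*} [TopologicalSpace M] [ChartedSpace EM M]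
  {EP : Finset ι → Type*} [∀ I, NormedAddCommGroup (EP I)] [∀ I, NormedSpace ℂ (EP I)]
  {P : Finset ι → Type*} [∀ I, TopologicalSpace (P I)] [∀ I, ChartedSpace (EP I) (P I)]

namespace StrataMaps

variable (T : StrataMaps (EM := EM) M EP P) {a b : ℕ}

/-- **The Čech differential on strata cochains** `(δ c)_J = Σ_j (-1)^j res^*(c_{J ∘ σ_j})`,
`σ_j = Fin.succAbove j` (Bott–Tu (1982), (8.4); same convention as the tree's `cechδ`).
[cite: BottTu1982Forms, §8 (8.4)] -/
def delta (c : SCochain EP P a b) : SCochain EP P (a + 1) b := fun J ↦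
  ∑ j : Fin (a + 2), (-1 : ℂ) ^ (j : ℕ) •
    (c (J ∘ Fin.succAbove j)).pullback 𝓘(ℝ, EP (tupleSupport J))
      (T.res (tupleSupport_comp_subset J (Fin.succAbove j)))

/-- **The restriction of an ambient form to the column `0`**: `(r x)_{(i)} = emb^* x` on
`P (tupleSupport (i))`. [cite: BottTu1982Forms, §8 (8.5)] -/
def sres (x : MForm 𝓘(ℝ, EM) M ℂ b) : SCochain EP P 0 b := fun J ↦
  x.pullback 𝓘(ℝ, EP (tupleSupport J)) (T.emb (tupleSupport J))

/-- `δ`, componentwise. [cite: BottTu1982Forms, §8 (8.4)] -/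
theorem delta_apply (c : SCochain EP P a b) (J : Fin (a + 2) → ι) :
    T.delta c J = ∑ j : Fin (a + 2), (-1 : ℂ) ^ (j : ℕ) •
      (c (J ∘ Fin.succAbove j)).pullback 𝓘(ℝ, EP (tupleSupport J))
        (T.res (tupleSupport_comp_subset J (Fin.succAbove j))) :=
  rfl

/-- Pull-back commutes with complex scalars. [folklore] -/
theorem pullback_csmul {E E' : Type*} [NormedAddCommGroup E] [NormedSpace ℂ E]
    [NormedAddCommGroup E'] [NormedSpace ℂ E'] {N N' : Type*} [TopologicalSpace N]
    [ChartedSpace E N] [TopologicalSpace N'] [ChartedSpace E' N'] (f : N → N') (c : ℂ)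
    (β : MForm 𝓘(ℝ, E') N' ℂ b) :
    (c • β).pullback 𝓘(ℝ, E) f = c • β.pullback 𝓘(ℝ, E) f := by
  funext x; ext v; simp [MForm.pullback_apply]

/-- Pull-back of a finite sum of forms. [folklore] -/
theorem pullback_sum {E E' : Type*} [NormedAddCommGroup E] [NormedSpace ℂ E]
    [NormedAddCommGroup E'] [NormedSpace ℂ E'] {N N' : Type*} [TopologicalSpace N]
    [ChartedSpace E N] [TopologicalSpace N'] [ChartedSpace E' N'] (f : N → N') {κ : Type*}
    (s : Finset κ) (g : κ → MForm 𝓘(ℝ, E') N' ℂ b) :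
    (∑ i ∈ s, g i).pullback 𝓘(ℝ, E) f = ∑ i ∈ s, (g i).pullback 𝓘(ℝ, E) f :=
  map_sum (MForm.pullbackₗ 𝓘(ℝ, E) f b) g s

/-- `δ` is additive. [folklore] -/
theorem delta_add (c c' : SCochain EP P a b) : T.delta (c + c') = T.delta c + T.delta c' := by
  funext J
  simp only [delta_apply, Pi.add_apply, MForm.pullback_add, smul_add, sum_add_distrib]

/-- `δ` commutes with complex scalars. [folklore] -/
theorem delta_smul (r : ℂ) (c : SCochain EP P a b) : T.delta (r • c) = r • T.delta c := by
  funext J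
  simp only [delta_apply, Pi.smul_apply, pullback_csmul, smul_sum, smul_comm r]

/-- `δ 0 = 0`. [folklore] -/
@[simp]
theorem delta_zero : T.delta (0 : SCochain EP P a b) = 0 := by
  funext J
  simp only [delta_apply, Pi.zero_apply, MForm.pullback_zero, smul_zero, sum_const_zero]

/-- `δ (-c) = -δ c`. [folklore] -/
theorem delta_neg (c : SCochain EP P a b) : T.delta (-c) = -T.delta c := by
  have h := T.delta_add c (-c)
  rw [add_neg_cancel, delta_zero] at h
  exact (neg_eq_of_add_eq_zero_right h.symm).symm

/-- The composite of two restrictions along faces is the restriction along the double face (the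
cocycle condition of the strata system, with the chain rule for pull-backs). [folklore] -/
theorem pullback_pullback_res (c : SCochain EP P a b) (J : Fin (a + 3) → ι) (i : Fin (a + 3))
    (j : Fin (a + 2)) :
    ((c ((J ∘ Fin.succAbove i) ∘ Fin.succAbove j)).pullback
        𝓘(ℝ, EP (tupleSupport (J ∘ Fin.succAbove i)))
        (T.res (tupleSupport_comp_subset (J ∘ Fin.succAbove i) (Fin.succAbove j)))).pullback
      𝓘(ℝ, EP (tupleSupport J)) (T.res (tupleSupport_comp_subset J (Fin.succAbove i))) =
    (c (J ∘ (Fin.succAbove i ∘ Fin.succAbove j))).pullback 𝓘(ℝ, EP (tupleSupport J))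
      (T.res (tupleSupport_comp_subset J (Fin.succAbove i ∘ Fin.succAbove j))) := by
  rw [← MForm.pullback_comp ((T.contMDiff_res _).mdifferentiable (by simp))
    ((T.contMDiff_res _).mdifferentiable (by simp)), T.res_comp_res]
  rfl

/-- **`δ ∘ δ = 0`** on strata cochains (the double faces cancel in pairs,
`Literature.Algebra.Homology.CechTuple.sum_sum_neg_one_pow_smul_smul_faces_eq_zero`).
[cite: BottTu1982Forms, §8 (8.4)] -/
theorem delta_delta (c : SCochain EP P a b) : T.delta (T.delta c) = 0 := by
  funext J
  rw [delta_apply, Pi.zero_apply]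
  simp_rw [delta_apply, pullback_sum, pullback_csmul, pullback_pullback_res, smul_sum]
  exact Literature.Algebra.Homology.CechTuple.sum_sum_neg_one_pow_smul_smul_faces_eq_zero (R := ℂ)
    (fun θ ↦ (c (J ∘ θ)).pullback 𝓘(ℝ, EP (tupleSupport J))
      (T.res (tupleSupport_comp_subset J θ)))

/-- **`δ ∘ r = 0`**: the restriction of an ambient form is a Čech `0`-cocycle
(`emb I ∘ res = emb J`). [cite: BottTu1982Forms, §8 (8.5)] -/
theorem delta_sres (x : MForm 𝓘(ℝ, EM) M ℂ b) : T.delta (T.sres x) = 0 := by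
  funext J
  have key : ∀ j : Fin 2, ((T.sres x) (J ∘ Fin.succAbove j)).pullback 𝓘(ℝ, EP (tupleSupport J))
      (T.res (tupleSupport_comp_subset J (Fin.succAbove j))) =
      x.pullback 𝓘(ℝ, EP (tupleSupport J)) (T.emb (tupleSupport J)) := by
    intro j
    rw [sres, ← MForm.pullback_comp ((T.contMDiff_emb _).mdifferentiable (by simp))
      ((T.contMDiff_res _).mdifferentiable (by simp)), T.emb_comp_res]
  rw [delta_apply, Pi.zero_apply, Fin.sum_univ_two, key, key]
  simp

variable [∀ I, IsManifold 𝓘(ℝ, EP I) ∞ (P I)]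

/-- `δ` preserves smoothness. [folklore] -/
theorem isSmoothForm_delta {c : SCochain EP P a b} (hc : ∀ J, IsSmoothForm (c J))
    (J : Fin (a + 2) → ι) : IsSmoothForm (T.delta c J) := by
  rw [delta_apply]
  refine (smoothForms 𝓘(ℝ, EP (tupleSupport J)) (P (tupleSupport J)) ℂ b).sum_mem fun j _ ↦ ?_
  exact (isSmoothForm_pullback (T.contMDiff_res _) (hc _)).smul_complex _

omit [∀ I, IsManifold 𝓘(ℝ, EP I) ∞ (P I)] in
/-- `δ` preserves the type `(p, q)` (the restrictions are holomorphic). [cite: VoisinHodgeI2002, §7.3.2] -/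
theorem isOfType_delta {p q : ℕ} {c : SCochain EP P a b} (hc : ∀ J, IsOfType p q (c J))
    (J : Fin (a + 2) → ι) : IsOfType p q (T.delta c J) := by
  have hpq : p + q = b := (hc (J ∘ Fin.succAbove 0)).add_eq
  rw [delta_apply]
  induction (Finset.univ : Finset (Fin (a + 2))) using Finset.induction_on with
  | empty => rw [sum_empty]; exact isOfType_zero hpq
  | insert j s hj ih =>
    rw [sum_insert hj]
    exact (((hc _).pullback (T.mdifferentiable_res _)).smul _).add ih

/-- **`d` commutes with `δ`** on smooth strata cochains (`d` is natural for `C^∞` maps).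
[cite: BottTu1982Forms, §8] -/
theorem mextDeriv_delta {c : SCochain EP P a b} (hc : ∀ J, IsSmoothForm (c J))
    (J : Fin (a + 2) → ι) :
    mextDeriv (T.delta c J) = T.delta (fun J' ↦ mextDeriv (c J')) J := by
  rw [delta_apply, delta_apply, mextDeriv_sum]
  · refine sum_congr rfl fun j _ ↦ ?_
    rw [mextDeriv_smul_complex_holds, mextDeriv_pullback (T.contMDiff_res _) (hc _)]
  · intro j _
    exact (isSmoothForm_pullback (T.contMDiff_res _) (hc _)).smul_complex _

variable [∀ I, IsManifold 𝓘(ℂ, EP I) ω (P I)] in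
/-- **`∂̄` commutes with `δ`** on smooth strata cochains of pure type (`∂̄` is natural for
holomorphic maps, `Literature.Analysis.Complex.dolbeaultBar_pullback_of_isOfType`).
[cite: VoisinHodgeI2002, §2.3.3] -/
theorem dolbeaultBar_delta {p q : ℕ} {c : SCochain EP P a b} (hc : ∀ J, IsSmoothForm (c J))
    (ht : ∀ J, IsOfType p q (c J)) (J : Fin (a + 2) → ι) :
    dolbeaultBar (T.delta c J) = T.delta (fun J' ↦ dolbeaultBar (c J')) J := by
  rw [delta_apply, delta_apply, dolbeaultBar_sum]
  · refine sum_congr rfl fun j _ ↦ ?_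
    rw [dolbeaultBar_smul_holds,
      Literature.Analysis.Complex.dolbeaultBar_pullback_of_isOfType (ht _) (hc _)
        (T.mdifferentiable_res _) (T.contMDiff_res _)]
  · intro j _
    exact (isSmoothForm_pullback (T.contMDiff_res _) (hc _)).smul_complex _

variable [IsManifold 𝓘(ℝ, EM) ∞ M] in
/-- The restriction of a smooth ambient form is smooth. [folklore] -/
theorem isSmoothForm_sres {x : MForm 𝓘(ℝ, EM) M ℂ b} (hx : IsSmoothForm x) (J : Fin 1 → ι) :
    IsSmoothForm (T.sres x J) :=
  isSmoothForm_pullback (T.contMDiff_emb _) hx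

omit [∀ I, IsManifold 𝓘(ℝ, EP I) ∞ (P I)] in
/-- The restriction of an ambient form of type `(p, q)` has type `(p, q)`. [cite: VoisinHodgeI2002, §7.3.2] -/
theorem isOfType_sres {p q : ℕ} {x : MForm 𝓘(ℝ, EM) M ℂ b} (hx : IsOfType p q x) (J : Fin 1 → ι) :
    IsOfType p q (T.sres x J) :=
  hx.pullback (T.mdifferentiable_emb _)

end StrataMaps

end Strata

/-! ### §2 The `∂∂̄`-descent: construction of the potentials -/

section Descent

variable {ι : Type} [DecidableEq ι]
  {EM : Type*} [NormedAddCommGroup EM] [NormedSpace ℂ EM]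
  {M : Type*} [TopologicalSpace M] [ChartedSpace EM M] [IsManifold 𝓘(ℝ, EM) ∞ M]
  {EP : Finset ι → Type*} [∀ I, NormedAddCommGroup (EP I)] [∀ I, NormedSpace ℂ (EP I)]
  [∀ I, FiniteDimensional ℂ (EP I)]
  {P : Finset ι → Type*} [∀ I, TopologicalSpace (P I)] [∀ I, ChartedSpace (EP I) (P I)]
  [∀ I, IsManifold 𝓘(ℂ, EP I) ω (P I)] [∀ I, IsManifold 𝓘(ℝ, EP I) ∞ (P I)]
  [∀ I, CompactSpace (P I)] [∀ I, T2Space (P I)] [∀ I, IsKaehlerManifold (EP I) (P I)]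
  (T : StrataMaps (EM := EM) M EP P)

namespace StrataMaps

/-- The hypothesis under which the level-`(a+1)` potential is produced from the Čech differential
`θ = δ c` of the level-`a` potential cochain `c` (types `(p - a, q)` at level `a`). [folklore] -/
def StepHyp (p q a d : ℕ) (c : SCochain EP P a (d + 1)) (J : Fin (a + 2) → ι) : Prop :=
  a + 1 ≤ p ∧ IsSmoothForm (T.delta c J) ∧ IsOfType (p - (a + 1) + 1) q (T.delta c J) ∧
    mextDeriv (dolbeaultBar (T.delta c J)) = 0

omit [IsManifold 𝓘(ℝ, EM) ∞ M] [∀ I, CompactSpace (P I)] [∀ I, T2Space (P I)]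
  [∀ I, IsKaehlerManifold (EP I) (P I)] [∀ I, FiniteDimensional ℂ (EP I)]
  [∀ I, IsManifold 𝓘(ℂ, EP I) ω (P I)] [∀ I, IsManifold 𝓘(ℝ, EP I) ∞ (P I)] in
/-- Unfolding of `StepHyp`. [folklore] -/
theorem StepHyp.out {p q a d : ℕ} {c : SCochain EP P a (d + 1)} {J : Fin (a + 2) → ι}
    (h : T.StepHyp p q a d c J) :
    a + 1 ≤ p ∧ IsSmoothForm (T.delta c J) ∧ IsOfType (p - (a + 1) + 1) q (T.delta c J) ∧
      mextDeriv (dolbeaultBar (T.delta c J)) = 0 :=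
  h

/-- The level-`(a+1)` potentials from the level-`a` ones: `(-1)^a β_J` where `∂̄ (δc)_J = ∂∂̄ β_J`
(`ddbar_of_dolbeaultBar` on the compact Kähler stratum), and `0` when the descent has stopped.
[cite: DeligneGriffithsMorganSullivan1975, §5] -/
def potStep (p q a d : ℕ) (c : SCochain EP P a (d + 1)) : SCochain EP P (a + 1) d := fun J ↦
  open Classical in
  if h : T.StepHyp p q a d c J then
    (-1 : ℂ) ^ a • Classical.choose (ddbar_of_dolbeaultBar h.out.2.1 h.out.2.2.1 h.out.2.2.2)
  else 0

omit [IsManifold 𝓘(ℝ, EM) ∞ M] in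
/-- The step under its hypothesis: smooth, of type `(p - (a+1), q)`, and
`∂̄ (δc)_J = (-1)^a ∂∂̄ (potStep c)_J`. [cite: DeligneGriffithsMorganSullivan1975, §5] -/
theorem potStep_spec {p q a d : ℕ} (c : SCochain EP P a (d + 1)) {J : Fin (a + 2) → ι}
    (h : T.StepHyp p q a d c J) :
    IsSmoothForm (T.potStep p q a d c J) ∧ IsOfType (p - (a + 1)) q (T.potStep p q a d c J) ∧
      dolbeaultBar (T.delta c J) =
        (-1 : ℂ) ^ a • dolbeault (dolbeaultBar (T.potStep p q a d c J)) := by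
  classical
  have hβ := Classical.choose_spec (ddbar_of_dolbeaultBar h.out.2.1 h.out.2.2.1 h.out.2.2.2)
  set β := Classical.choose (ddbar_of_dolbeaultBar h.out.2.1 h.out.2.2.1 h.out.2.2.2) with hβdef
  have hstep : T.potStep p q a d c J = (-1 : ℂ) ^ a • β := by
    simp only [potStep, dif_pos h]
    rfl
  rw [hstep]
  refine ⟨hβ.1.smul_complex _, hβ.2.1.smul _, ?_⟩
  rw [dolbeaultBar_smul_holds, dolbeault_smul_holds, smul_smul, ← pow_add, ← two_mul,
    pow_mul, neg_one_sq, one_pow, one_smul]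
  exact hβ.2.2

omit [IsManifold 𝓘(ℝ, EM) ∞ M] in
/-- Off its hypothesis the step vanishes. [folklore] -/
theorem potStep_of_not {p q a d : ℕ} (c : SCochain EP P a (d + 1)) {J : Fin (a + 2) → ι}
    (h : ¬ T.StepHyp p q a d c J) : T.potStep p q a d c J = 0 := by
  classical
  simp only [potStep, dif_neg h]

variable {p q k : ℕ} {x : MForm 𝓘(ℝ, EM) M ℂ (k + 1 + 1)}
  (hxs : IsSmoothForm x) (hxt : IsOfType (p + 1) (q + 1) x)
  (hx : ∀ J : Fin 1 → ι, ∃ α : MForm 𝓘(ℝ, EP (tupleSupport J)) (P (tupleSupport J)) ℂ (k + 1),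
    IsSmoothForm α ∧ T.sres x J = mextDeriv α)

/-- The level-`0` potential: `x|_{P (i)} = ∂∂̄ μ_{(i)}` with `μ` smooth of type `(p, q)`
(`ddbar_of_exact` on the compact Kähler stratum). [cite: DeligneGriffithsMorganSullivan1975, §5] -/
def pot₀ (J : Fin 1 → ι) : MForm 𝓘(ℝ, EP (tupleSupport J)) (P (tupleSupport J)) ℂ k :=
  Classical.choose (ddbar_of_exact (T.isSmoothForm_sres hxs J) (T.isOfType_sres hxt J)
    (Classical.choose_spec (hx J)).1 (Classical.choose_spec (hx J)).2)

/-- The defining property of the level-`0` potential. [cite: DeligneGriffithsMorganSullivan1975, §5] -/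
theorem pot₀_spec (J : Fin 1 → ι) :
    IsSmoothForm (T.pot₀ hxs hxt hx J) ∧ IsOfType p q (T.pot₀ hxs hxt hx J) ∧
      T.sres x J = dolbeault (dolbeaultBar (T.pot₀ hxs hxt hx J)) :=
  Classical.choose_spec (ddbar_of_exact (T.isSmoothForm_sres hxs J) (T.isOfType_sres hxt J)
    (Classical.choose_spec (hx J)).1 (Classical.choose_spec (hx J)).2)

/-- **The potentials of the descent**, all levels `a` and all degrees `d` (meaningful for
`a + d = k`; junk `0` elsewhere): `pot 0 k = μ`, `pot (a+1) d = potStep (pot a (d+1))`.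
[cite: DeligneGriffithsMorganSullivan1975, §5] -/
def pot : (a d : ℕ) → SCochain EP P a d
  | 0, d => fun J ↦ if h : k = d then (T.pot₀ hxs hxt hx J).castDeg h else 0
  | a + 1, d => T.potStep p q a d (pot a (d + 1))

/-- `pot 0 k` is the level-`0` potential. [folklore] -/
theorem pot_zero (J : Fin 1 → ι) : T.pot hxs hxt hx 0 k J = T.pot₀ hxs hxt hx J := by
  simp [pot]

/-- `pot 0 d = 0` for `d ≠ k`. [folklore] -/
theorem pot_zero_of_ne {d : ℕ} (hd : k ≠ d) (J : Fin 1 → ι) : T.pot hxs hxt hx 0 d J = 0 := by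
  simp [pot, hd]

/-- `pot (a+1) d` is the step applied to `pot a (d+1)`. [folklore] -/
theorem pot_succ (a d : ℕ) :
    T.pot hxs hxt hx (a + 1) d = T.potStep p q a d (T.pot hxs hxt hx a (d + 1)) :=
  rfl

/-! ### §3 The invariants of the descent and the main theorem -/

omit [IsManifold 𝓘(ℝ, EM) ∞ M] [∀ I, CompactSpace (P I)] [∀ I, T2Space (P I)]
  [∀ I, IsKaehlerManifold (EP I) (P I)] [∀ I, FiniteDimensional ℂ (EP I)] [DecidableEq ι] in
/-- `d ∂̄ β = ∂∂̄ β` for a smooth form (`d = ∂ + ∂̄`, `∂̄² = 0`). [cite: VoisinHodgeI2002, §2.3.3] -/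
theorem mextDeriv_dolbeaultBar_eq {I : Finset ι} {m : ℕ} {β : MForm 𝓘(ℝ, EP I) (P I) ℂ m}
    (hβ : IsSmoothForm β) : mextDeriv (dolbeaultBar β) = dolbeault (dolbeaultBar β) := by
  rw [mextDeriv_eq_dolbeault_add_dolbeaultBar_holds hβ.dolbeaultBar, dolbeaultBar_dolbeaultBar_holds hβ,
    add_zero]

/-- **Every potential is smooth** (in all bidegrees, including the junk ones). [folklore] -/
theorem pot_smooth : ∀ (a d : ℕ) (J : Fin (a + 1) → ι), IsSmoothForm (T.pot hxs hxt hx a d J)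
  | 0, d, J => by
    by_cases h : k = d
    · subst h; rw [pot_zero]; exact (T.pot₀_spec hxs hxt hx J).1
    · rw [T.pot_zero_of_ne hxs hxt hx h]; exact isSmoothForm_zero
  | a + 1, d, J => by
    rw [pot_succ]
    by_cases h : T.StepHyp p q a d (T.pot hxs hxt hx a (d + 1)) J
    · exact (T.potStep_spec _ h).1
    · rw [T.potStep_of_not _ h]; exact isSmoothForm_zero

/-- The step hypothesis at level `a + 1 ≤ p` from the invariants of level `a`: `θ = δ pot_a` is
smooth of type `(p - a, q)` and `d ∂̄ θ = δ (∂∂̄ pot_a) = 0`. [cite: DeligneGriffithsMorganSullivan1975, §5] -/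
theorem stepHyp_of_inv {a d : ℕ} (hap : a + 1 ≤ p)
    (ht : ∀ J, IsOfType (p - a) q (T.pot hxs hxt hx a (d + 1) J))
    (hkey : ∀ J, T.delta (fun J' ↦ dolbeault (dolbeaultBar (T.pot hxs hxt hx a (d + 1) J'))) J = 0)
    (J : Fin (a + 2) → ι) : T.StepHyp p q a d (T.pot hxs hxt hx a (d + 1)) J := by
  have hs : ∀ J, IsSmoothForm (T.pot hxs hxt hx a (d + 1) J) := fun J ↦ T.pot_smooth hxs hxt hx a (d + 1) J
  refine ⟨hap, T.isSmoothForm_delta hs J, ?_, ?_⟩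
  · have e : p - (a + 1) + 1 = p - a := by omega
    rw [e]
    exact T.isOfType_delta ht J
  · rw [T.dolbeaultBar_delta hs ht J, T.mextDeriv_delta (fun J' ↦ (hs J').dolbeaultBar) J]
    have hfun : (fun J' ↦ mextDeriv (dolbeaultBar (T.pot hxs hxt hx a (d + 1) J'))) =
        fun J' ↦ dolbeault (dolbeaultBar (T.pot hxs hxt hx a (d + 1) J')) :=
      funext fun J' ↦ mextDeriv_dolbeaultBar_eq (hs J')
    rw [hfun]
    exact hkey J

/-- **The invariants of the descent** at level `a` and degree `d` with `a + d = k`: the potentials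
have type `(p - a, q)` while `a ≤ p`, vanish beyond level `p`, and `δ(∂∂̄ pot_a) = 0` (level `0`:
`∂∂̄ pot₀ = x|` and `δ ∘ r = 0`; level `a + 1`: `∂∂̄ pot_{a+1} = (-1)^a δ(∂̄ pot_a)` and `δ ∘ δ = 0`).
[cite: DeligneGriffithsMorganSullivan1975, §5] -/
theorem pot_inv : ∀ (a d : ℕ), a + d = k →
    (a ≤ p → ∀ J, IsOfType (p - a) q (T.pot hxs hxt hx a d J)) ∧
    (p < a → ∀ J, T.pot hxs hxt hx a d J = 0) ∧
    (∀ J, T.delta (fun J' ↦ dolbeault (dolbeaultBar (T.pot hxs hxt hx a d J'))) J = 0) := by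
  intro a
  induction a with
  | zero =>
    intro d hd
    obtain rfl : k = d := by omega
    refine ⟨fun _ J ↦ ?_, fun h ↦ absurd h (Nat.not_lt_zero _), fun J ↦ ?_⟩
    · rw [pot_zero, Nat.sub_zero]; exact (T.pot₀_spec hxs hxt hx J).2.1
    · have hfun : (fun J' ↦ dolbeault (dolbeaultBar (T.pot hxs hxt hx 0 k J'))) = T.sres x := by
        funext J'; rw [pot_zero]; exact (T.pot₀_spec hxs hxt hx J').2.2.symm
      rw [hfun, T.delta_sres]
      rfl
  | succ a ih =>
    intro d hd
    obtain ⟨ht, hz, hkey⟩ := ih (d + 1) (by omega)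
    have hs : ∀ J, IsSmoothForm (T.pot hxs hxt hx a (d + 1) J) :=
      fun J ↦ T.pot_smooth hxs hxt hx a (d + 1) J
    by_cases hap : a + 1 ≤ p
    · have hH : ∀ J, T.StepHyp p q a d (T.pot hxs hxt hx a (d + 1)) J :=
        fun J ↦ T.stepHyp_of_inv hxs hxt hx hap (ht (by omega)) hkey J
      refine ⟨fun _ J ↦ ?_, fun h ↦ absurd hap (by omega), fun J ↦ ?_⟩
      · rw [pot_succ]; exact (T.potStep_spec _ (hH J)).2.1
      · have hfun : (fun J' ↦ dolbeault (dolbeaultBar (T.pot hxs hxt hx (a + 1) d J'))) =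
            (-1 : ℂ) ^ a • T.delta (fun J' ↦ dolbeaultBar (T.pot hxs hxt hx a (d + 1) J')) := by
          funext J'
          rw [Pi.smul_apply, pot_succ]
          have h3 := (T.potStep_spec _ (hH J')).2.2
          rw [T.dolbeaultBar_delta hs (ht (by omega)) J'] at h3
          rw [h3, smul_smul, ← pow_add, ← two_mul, pow_mul, neg_one_sq, one_pow, one_smul]
        rw [hfun, T.delta_smul, Pi.smul_apply, T.delta_delta, Pi.zero_apply, smul_zero]
    · have h0 : ∀ J, T.pot hxs hxt hx (a + 1) d J = 0 := fun J ↦ by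
        rw [pot_succ]; exact T.potStep_of_not _ (fun h ↦ hap h.out.1)
      refine ⟨fun h ↦ absurd h hap, fun _ ↦ h0, fun J ↦ ?_⟩
      have hfun : (fun J' ↦ dolbeault (dolbeaultBar (T.pot hxs hxt hx (a + 1) d J'))) = 0 := by
        funext J'; rw [h0, dolbeaultBar_zero, dolbeault_zero]; rfl
      rw [hfun, T.delta_zero]
      rfl

/-- **The descent equation at a level `a + 1 ≤ p`**: `δ(∂̄ pot_a) = (-1)^a ∂∂̄ pot_{a+1}`.
[cite: DeligneGriffithsMorganSullivan1975, §5] -/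
theorem delta_dolbeaultBar_pot_of_le {a d : ℕ} (hap : a + 1 ≤ p) (hd : a + (d + 1) = k)
    (J : Fin (a + 2) → ι) :
    T.delta (fun J' ↦ dolbeaultBar (T.pot hxs hxt hx a (d + 1) J')) J =
      (-1 : ℂ) ^ a • dolbeault (dolbeaultBar (T.pot hxs hxt hx (a + 1) d J)) := by
  obtain ⟨ht, -, hkey⟩ := T.pot_inv hxs hxt hx a (d + 1) hd
  have hs : ∀ J, IsSmoothForm (T.pot hxs hxt hx a (d + 1) J) :=
    fun J ↦ T.pot_smooth hxs hxt hx a (d + 1) J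
  have hH := T.stepHyp_of_inv hxs hxt hx hap (ht (by omega)) hkey J
  rw [← T.dolbeaultBar_delta hs (ht (by omega)) J, pot_succ]
  exact (T.potStep_spec _ hH).2.2

/-- **The descent stops at level `p`**: `δ(∂̄ pot_a) = 0` for `p ≤ a` (at `a = p`, `θ = δ pot_p` has
type `(0, q)` and `d ∂̄θ = 0`, so `∂̄θ = 0` by `dolbeaultBar_eq_zero_of_isOfType_zero_left`; beyond,
`pot_a = 0`). [cite: DeligneGriffithsMorganSullivan1975, §5] -/
theorem delta_dolbeaultBar_pot_of_ge {a d : ℕ} (hpa : p ≤ a) (hd : a + d = k)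
    (J : Fin (a + 2) → ι) :
    T.delta (fun J' ↦ dolbeaultBar (T.pot hxs hxt hx a d J')) J = 0 := by
  obtain ⟨ht, hz, hkey⟩ := T.pot_inv hxs hxt hx a d hd
  have hs : ∀ J, IsSmoothForm (T.pot hxs hxt hx a d J) := fun J ↦ T.pot_smooth hxs hxt hx a d J
  rcases hpa.eq_or_lt with rfl | hlt
  · rw [← T.dolbeaultBar_delta hs (ht le_rfl) J]
    have htθ : IsOfType 0 q (T.delta (T.pot hxs hxt hx p d) J) := by
      have := T.isOfType_delta (ht le_rfl) J
      rwa [Nat.sub_self] at this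
    refine dolbeaultBar_eq_zero_of_isOfType_zero_left (T.isSmoothForm_delta hs J) htθ ?_
    rw [T.dolbeaultBar_delta hs (ht le_rfl) J, T.mextDeriv_delta (fun J' ↦ (hs J').dolbeaultBar) J]
    have hfun : (fun J' ↦ mextDeriv (dolbeaultBar (T.pot hxs hxt hx p d J'))) =
        fun J' ↦ dolbeault (dolbeaultBar (T.pot hxs hxt hx p d J')) :=
      funext fun J' ↦ mextDeriv_dolbeaultBar_eq (hs J')
    rw [hfun]
    exact hkey J
  · have hfun : (fun J' ↦ dolbeaultBar (T.pot hxs hxt hx a d J')) = 0 := by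
      funext J'; rw [hz hlt, dolbeaultBar_zero]; rfl
    rw [hfun, T.delta_zero]
    rfl

/-- **The descent data** `η` in all bidegrees: `η_{a, d+1} = ∂̄ pot_{a, d}`, `η_{a, 0} = 0`.
[cite: DeligneGriffithsMorganSullivan1975, §5] -/
def eta (a : ℕ) : (b : ℕ) → SCochain EP P a b
  | 0 => 0
  | d + 1 => fun J ↦ dolbeaultBar (T.pot hxs hxt hx a d J)

/-- `η_{a, d+1} = ∂̄ pot_{a, d}`. [folklore] -/
theorem eta_succ (a d : ℕ) :
    T.eta hxs hxt hx a (d + 1) = fun J ↦ dolbeaultBar (T.pot hxs hxt hx a d J) :=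
  rfl

/-- `η_{a, d+1} = ∂̄ pot_{a, d}`, componentwise. [folklore] -/
theorem eta_succ_apply (a d : ℕ) (J : Fin (a + 1) → ι) :
    T.eta hxs hxt hx a (d + 1) J = dolbeaultBar (T.pot hxs hxt hx a d J) :=
  rfl

/-- `η_{a, 0} = 0`. [folklore] -/
theorem eta_zero_right (a : ℕ) : T.eta hxs hxt hx a 0 = 0 :=
  rfl

/-- Every `η_{a,b}` is smooth. [folklore] -/
theorem eta_smooth : ∀ (a b : ℕ) (J : Fin (a + 1) → ι), IsSmoothForm (T.eta hxs hxt hx a b J)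
  | _, 0, _ => isSmoothForm_zero
  | a, d + 1, J => (T.pot_smooth hxs hxt hx a d J).dolbeaultBar

/-- **Level `0`: `d η_{(i)} = x|_{P (i)}`** (`d ∂̄ μ = ∂∂̄ μ = x|`).
[cite: DeligneGriffithsMorganSullivan1975, §5] -/
theorem mextDeriv_eta_zero (J : Fin 1 → ι) :
    mextDeriv (T.eta hxs hxt hx 0 (k + 1) J) = T.sres x J := by
  rw [eta_succ_apply, mextDeriv_dolbeaultBar_eq (T.pot_smooth hxs hxt hx 0 k J), pot_zero]
  exact (T.pot₀_spec hxs hxt hx J).2.2.symm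

/-- **The descent equations `δ η_a + (-1)^{a+1} d η_{a+1} = 0`** on the antidiagonal `a + b = k`.
[cite: DeligneGriffithsMorganSullivan1975, §5] -/
theorem delta_eta_add (a b : ℕ) (h : a + b = k) (J : Fin (a + 2) → ι) :
    T.delta (T.eta hxs hxt hx a (b + 1)) J +
      (-1 : ℂ) ^ (a + 1) • mextDeriv (T.eta hxs hxt hx (a + 1) b J) = 0 := by
  have hpq : p + q = k := by have := hxt.add_eq; omega
  rcases b with - | d
  · -- `b = 0`: `a = k ≥ p`
    rw [eta_succ, eta_zero_right, Pi.zero_apply, mextDeriv_zero, smul_zero, add_zero]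
    exact T.delta_dolbeaultBar_pot_of_ge hxs hxt hx (by omega) h J
  · rw [eta_succ, eta_succ_apply]
    by_cases hap : a + 1 ≤ p
    · rw [T.delta_dolbeaultBar_pot_of_le hxs hxt hx hap h J,
        mextDeriv_dolbeaultBar_eq (T.pot_smooth hxs hxt hx (a + 1) d J), pow_succ, mul_neg_one,
        neg_smul, add_neg_cancel]
    · rw [T.delta_dolbeaultBar_pot_of_ge hxs hxt hx (by omega) h J, zero_add]
      obtain ⟨-, hz, -⟩ := T.pot_inv hxs hxt hx (a + 1) d (by omega)
      rw [hz (by omega), dolbeaultBar_zero, mextDeriv_zero, smul_zero]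

/-- **The `∂∂̄`-descent on a strata system** (DGMS (1975), §5; the compact-Kähler core of Deligne's
Hodge III, 8.2.7–8.2.8 for a normal crossing configuration). Let `T` be a strata system whose strata
are compact Hausdorff Kähler manifolds, and `x` a smooth complex form of degree `k + 2` and pure type
`(p + 1, q + 1)` on the ambient manifold whose restriction to each stratum `P (tupleSupport (i))` is
`d`-exact. Then there is a strata cochain `η` of smooth forms (all bidegrees) with
`d η_{0, k+1} = x|` in column `0` and `δ η_{a, b+1} + (-1)^{a+1} d η_{a+1, b} = 0` for `a + b = k`:
`(x|_{P (i)})_i` is a coboundary of the total strata complex. [cite: DeligneGriffithsMorganSullivan1975, §5]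
[cite: DeligneHodgeIII1974, Cor. 8.2.8] -/
theorem exists_ddbar_descent (hxs : IsSmoothForm x) (hxt : IsOfType (p + 1) (q + 1) x)
    (hx : ∀ J : Fin 1 → ι, ∃ α : MForm 𝓘(ℝ, EP (tupleSupport J)) (P (tupleSupport J)) ℂ (k + 1),
      IsSmoothForm α ∧ T.sres x J = mextDeriv α) :
    ∃ η : (a b : ℕ) → SCochain EP P a b,
      (∀ a b J, IsSmoothForm (η a b J)) ∧
      (∀ J : Fin 1 → ι, mextDeriv (η 0 (k + 1) J) = T.sres x J) ∧
      (∀ a b, a + b = k → ∀ J : Fin (a + 2) → ι,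
        T.delta (η a (b + 1)) J + (-1 : ℂ) ^ (a + 1) • mextDeriv (η (a + 1) b J) = 0) :=
  ⟨T.eta hxs hxt hx, T.eta_smooth hxs hxt hx, T.mextDeriv_eta_zero hxs hxt hx,
    T.delta_eta_add hxs hxt hx⟩

end StrataMaps

end Descent

end Literature.Geometry.Kaehler
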